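import Summits.Ventures.QEC.Census.CertCoverBatch
import Summits.Ventures.QEC.Census.BB.A1s_n180_k8_51b6db11.CoreDefs
import HarnessLib

set_option Elab.async false
set_option maxRecDepth 200000

/-!
# `[[180,8,16]]` one-level cover certificate of `A1s_n180_k8_51b6db11` — LEVEL-1→0 coset problems 207…232 (deep problems [46] excluded: `ProbDeep*.lean`) as COMPACT data
(`ProbData`: U, f, σ, y₀, allow; qec-type-10 `CertCoverBatch.mkCoset` rebuilds each `CosetProb` in the kernel) + their verdict
`probsOK cov covR hx hx1 D1 lxd 14` (one `decide +kernel`; 26 problems, depths f=0:20 f=1:6 f=2:0 f=3:0, est. 118.0 s).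
qec-search-1 g5 (pattern of search-9 g5 `Probs*`); data from JSON `level10.problems` (sha256 cdf2fcfc3865e75f…). Data + decided check; KERNEL.
-/

namespace Summit.Ventures.QEC.Census.A1s_n180_k8_51b6db11

open Matrix Summit.Ventures.QEC.Census Literature.InformationTheory.QuantumCodes

/-- Problems 207…232 (26): `⟨U, f, σ, y₀, allow⟩`. -/
def probs04b : List ProbData := [
    ⟨415798985664192283934734, 0, 5375201472, 75705586297326062796806, []⟩,
    ⟨417348505516383211159566, 0, 8803659747331, 415577473864565633679368, []⟩,
    ⟨420294130064582750183426, 0, 8804011902472, 4722420807540150575105, []⟩,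
    ⟨420511984941311975686144, 0, 5509218504, 80427808946482609061888, []⟩,
    ⟨425026824713170887778312, 0, 8872328822960, 113336801218376390314496, []⟩,
    ⟨428554770705594156589056, 1, 8799414911328, 341190978387655147294725, []⟩,
    ⟨491141336385183614525448, 1, 26394453252608, 340020835117749954936842, [2, 4]⟩,
    ⟨491213954677495409147913, 0, 4297234496, 188973204344138503290882, []⟩,
    ⟨491730461294824381251593, 0, 26393664722945, 151710779098579033128962, []⟩,
    ⟨498210835300863151759361, 0, 26394654409228, 304592656300228114505728, []⟩,
    ⟨498283453593174946381824, 0, 4498391116, 342445359376932958208000, []⟩,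
    ⟨642261747580624726679581, 1, 26401969676800, 604481374565786806411280, [0]⟩,
    ⟨717821953178345282740254, 0, 8810320537088, 113340542583761457381391, []⟩,
    ⟨793382158776065838833690, 0, 26405191002624, 151120645382621735444488, [0]⟩,
    ⟨944502569971506950987795, 0, 26399822131712, 604481518680974882267158, []⟩,
    ⟨1020062775569227507048464, 0, 8808172992000, 302241020549265828618245, []⟩,
    ⟨1246743392362389175296057, 1, 26414854980096, 594475150812930072, [0]⟩,
    ⟨1322303597960109731356730, 0, 8823205840384, 113340830814137609093147, []⟩,
    ⟨1851225037144153623912485, 0, 26410559889920, 642262017796602368884745, []⟩,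
    ⟨2455705529039597837770865, 1, 26440625553921, 2417925444219951697125440, [0]⟩,
    ⟨2531265734637318393831538, 0, 8848976414209, 54078379900543025, []⟩,
    ⟨3664668818603126735003721, 0, 26432035373569, 1246742797922422734454801, []⟩,
    ⟨4873630955280335397478625, 1, 26492166734338, 4873630937195568143794305, [0]⟩,
    ⟨4949191160878055953539298, 0, 8900517594626, 4835850906454301903691905, []⟩,
    ⟨7291556381521072957186193, 0, 26474986340867, 4835850870460689256833200, []⟩,
    ⟨9785042013359531072954818, 0, 9003599955460, 54183933016809665, []⟩]

set_option maxHeartbeats 400000000 in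
/-- Every problem of this chunk passes (`mkCoset` elimination + `cosetOKD` + fast `σ` + depth + `BU`-evenness + label checks). -/
theorem probs04b_ok : probsOK A1s_n180_k8_51b6db11.cov covR hx hx1 D1 lxd 14 probs04b = true := by
  decide +kernel

/-- Pointwise form. -/
theorem probs04b_all : ∀ x ∈ probs04b, probOK A1s_n180_k8_51b6db11.cov covR hx hx1 D1 lxd 14 x = true := by
  have h := probs04b_ok
  rwa [probsOK, List.all_eq_true] at h

end Summit.Ventures.QEC.Census.A1s_n180_k8_51b6db11
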